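import Literature.NumberTheory.Irrationality.Fischler2002.Theoreme32OrderTwoProofs
import Literature.NumberTheory.Irrationality.Fischler2002.Theoreme32StepProofs
import Literature.NumberTheory.Irrationality.Fischler2002.Theoreme32RouteTwoProofs
import Literature.NumberTheory.Irrationality.Fischler2002.JnFinitenessCriterionProofs
import HarnessLib

/-!
# Fischler 2002, Théorème 3.2 — brick XI: the Rhin–Viola clause and the invariance of `𝒥/N` for `n = 2`

Topic `Literature/NumberTheory/Irrationality/Fischler2002`. PROOFS ONLY (no definition, no statement, no discharge of the `∀ n ≥ 2` fact):
for `n = 2` and any permutations `σ', ψ', φ'` of `{p // InE 2 p}` with underlying maps `sigma, psi 2, phi 2`, the two last clauses of the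
typed `theoreme32` HOLD (`invariance_two`, `isRhinViolaGroup_two`), hence all of Théorème 3.2 for `n = 2` (`theoreme32_two`):
« Pour `n = 2`, le groupe `G` est isomorphe à `𝔖₅`, et laisse stable `𝒥(p)/(a₁! a₂! b₁! b₂! (a₁+b₂−c₂)!)` » [Fischler2002Polyzetas, §3 Th. 3.2].
PROOF = bricks II, V, X assembled: `g` permutes the ten forms `ℓ_{st}` through `π_g ∈ 𝔖₅` (brick II); for `n = 2` Fischler's criterion is
the non-negativity of `a₁ = ℓ₁₄, a₂ = ℓ₁₃, b₁ = ℓ₀₃, b₂ = ℓ₀₂, a₁+b₂−c₂ = ℓ₂₄` (`crit2_iff`), so `hp` is in the criterion iff the five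
forms `ℓ_{π_h s, π_h t}` (`st` on that 5-cycle) are non-negative at `p`; brick X's kernel-checked ROUTING in `𝔖₅` gives a word in
`σ', ψ', φ'` with `π_w = π_g` all of whose right factors are allowed; the word equals `g` (brick II's faithfulness) and brick V's
`transport` carries `𝒥/N`. Cell `pub-zeta5`, seat ct-1 g33, 2026-08-28. [cite: Fischler2002Polyzetas, §3 Théorème 3.2]
[cite: Fischler2003RhinViola, §3.3 Théorème 5, §3.4 Théorème 6]

HONEST FRAMING (cell pub-zeta5): systematic search; no irrationality claim unless certified — identities between (possibly infinite) integrals of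
non-negative functions and finite bookkeeping; nothing about `ζ(5)`.
-/

noncomputable section

namespace Literature.NumberTheory.Irrationality.Fischler2002

namespace Theoreme32

open Equiv JnFinite
open scoped ENNReal

/-- **Fischler's criterion for `n = 2`**: `a₁, a₂, b₁, b₂ ≥ 0` and `a₁ + b₂ − c₂ ≥ 0` (`ρ₂ = c₂ − b₂ ≤ a₁`, `ρ₁ = −b₁ ≤ 0`).
[cite: Fischler2002Polyzetas, §3 p. 4 (critère de finitude), n = 2] -/
theorem crit2_iff (p : Exponents) :
    FinitenessCriterionGen 2 p ↔ 0 ≤ p.a 1 ∧ 0 ≤ p.a 2 ∧ 0 ≤ p.b 1 ∧ 0 ≤ p.b 2 ∧ 0 ≤ p.a 1 + p.b 2 - p.c 2 := by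
  have hr2 : rho 2 p 2 = p.c 2 - p.b 2 := by
    rw [rho_of_le p (le_refl 2), rho_of_lt p (by norm_num : 2 < 4)]; simp [cTilde]
  have hr1 : rho 2 p 1 = -p.b 1 := by
    rw [rho_of_le p (by norm_num : 1 ≤ 2), rho_of_lt p (by norm_num : 2 < 3)]; simp [cTilde]
  have hI : Finset.Icc 1 2 = {1, 2} := by decide
  simp only [FinitenessCriterionGen, hI, Finset.mem_insert, Finset.mem_singleton, forall_eq_or_imp, forall_eq, hr1, hr2]
  constructor
  · rintro ⟨⟨ha1, ha2⟩, ⟨hb1, hb2⟩, -, h2⟩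
    simp only [show (2 : ℕ) ≠ 1 by norm_num, if_false, show 2 - 1 = 1 from rfl] at h2
    exact ⟨ha1, ha2, hb1, hb2, by linarith⟩
  · rintro ⟨ha1, ha2, hb1, hb2, h5⟩
    refine ⟨⟨ha1, ha2⟩, ⟨hb1, hb2⟩, by simp; linarith, ?_⟩
    simp only [show (2 : ℕ) ≠ 1 by norm_num, if_false, show 2 - 1 = 1 from rfl]
    linarith

/-- The five sign bits of `b = ε₁ + 2ε₂ + 4ε₃ + 8ε₄ + 16ε₅`. [cite: Fischler2002Polyzetas, §3 Théorème 3.2] -/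
theorem bits5_spec (P₁ P₂ P₃ P₄ P₅ : Prop) [Decidable P₁] [Decidable P₂] [Decidable P₃] [Decidable P₄] [Decidable P₅] :
    (if P₁ then 1 else 0) + (if P₂ then 2 else 0) + (if P₃ then 4 else 0) + (if P₄ then 8 else 0) + (if P₅ then 16 else 0) < 32 ∧
    (((if P₁ then 1 else 0) + (if P₂ then 2 else 0) + (if P₃ then 4 else 0) + (if P₄ then 8 else 0) + (if P₅ then 16 else 0)) % 2 = 1
      ↔ P₁) ∧
    (((if P₁ then 1 else 0) + (if P₂ then 2 else 0) + (if P₃ then 4 else 0) + (if P₄ then 8 else 0) + (if P₅ then 16 else 0)) / 2 % 2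
      = 1 ↔ P₂) ∧
    (((if P₁ then 1 else 0) + (if P₂ then 2 else 0) + (if P₃ then 4 else 0) + (if P₄ then 8 else 0) + (if P₅ then 16 else 0)) / 4 % 2
      = 1 ↔ P₃) ∧
    (((if P₁ then 1 else 0) + (if P₂ then 2 else 0) + (if P₃ then 4 else 0) + (if P₄ then 8 else 0) + (if P₅ then 16 else 0)) / 8 % 2
      = 1 ↔ P₄) ∧
    (((if P₁ then 1 else 0) + (if P₂ then 2 else 0) + (if P₃ then 4 else 0) + (if P₄ then 8 else 0) + (if P₅ then 16 else 0)) / 16 % 2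
      = 1 ↔ P₅) := by
  by_cases h1 : P₁ <;> by_cases h2 : P₂ <;> by_cases h3 : P₃ <;> by_cases h4 : P₄ <;> by_cases h5 : P₅ <;> simp [h1, h2, h3, h4, h5]

section Two

variable {ℓ : Fin 5 → Fin 5 → Exponents → ℤ}
  (hℓ : ∀ (s t : Fin 5) (p : Exponents), ℓ s t p =
    if min s.val t.val * 5 + max s.val t.val = 1 then p.c 2
    else if min s.val t.val * 5 + max s.val t.val = 2 then p.b 2
    else if min s.val t.val * 5 + max s.val t.val = 3 then p.b 1
    else if min s.val t.val * 5 + max s.val t.val = 4 then p.a 1 - p.a 2 + p.b 1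
    else if min s.val t.val * 5 + max s.val t.val = 7 then p.a 2 - p.b 1 + p.b 2
    else if min s.val t.val * 5 + max s.val t.val = 8 then p.a 2
    else if min s.val t.val * 5 + max s.val t.val = 9 then p.a 1
    else if min s.val t.val * 5 + max s.val t.val = 13 then p.a 2 + p.b 2 - p.c 2
    else if min s.val t.val * 5 + max s.val t.val = 14 then p.a 1 + p.b 2 - p.c 2
    else if min s.val t.val * 5 + max s.val t.val = 19 then p.a 1 + p.b 1 - p.c 2 else 0)
  {gσ gψ gφ : Perm {p : Exponents // InE 2 p}}

include hℓ in
/-- **The criterion along the orbit (`n = 2`)**: if `h` permutes the ten forms through `π` then `hp` is in the criterion iff the five forms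
`ℓ_{π s, π t}`, `st ∈ {14, 13, 03, 02, 24}`, are non-negative at `p`. [cite: Fischler2002Polyzetas, §3 Théorème 3.2] -/
theorem crit2_iff_pi {h : Perm {p : Exponents // InE 2 p}} {π : Perm (Fin 5)}
    (hh : ∀ s t : Fin 5, s ≠ t → ∀ p, ℓ s t (h p).1 = ℓ (π s) (π t) p.1) (p : {p : Exponents // InE 2 p}) :
    FinitenessCriterionGen 2 (h p).1 ↔
      ∀ st ∈ [((1 : Fin 5), (4 : Fin 5)), (1, 3), (0, 3), (0, 2), (2, 4)], 0 ≤ ℓ (π st.1) (π st.2) p.1 := by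
  rw [crit2_iff]
  have e14 := hh 1 4 (by decide) p; have e13 := hh 1 3 (by decide) p; have e03 := hh 0 3 (by decide) p
  have e02 := hh 0 2 (by decide) p; have e24 := hh 2 4 (by decide) p
  have t14 : ℓ 1 4 (h p).1 = (h p).1.a 1 := by simp [hℓ]
  have t13 : ℓ 1 3 (h p).1 = (h p).1.a 2 := by simp [hℓ]
  have t03 : ℓ 0 3 (h p).1 = (h p).1.b 1 := by simp [hℓ]
  have t02 : ℓ 0 2 (h p).1 = (h p).1.b 2 := by simp [hℓ]
  have t24 : ℓ 2 4 (h p).1 = (h p).1.a 1 + (h p).1.b 2 - (h p).1.c 2 := by simp [hℓ]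
  simp only [List.mem_cons, forall_eq_or_imp, List.not_mem_nil, false_imp_iff, imp_true_iff, and_true]
  rw [← e14, ← e13, ← e03, ← e02, ← e24, t14, t13, t03, t02, t24]

include hℓ in
/-- **The relation along words (`n = 2`)**: the product `h` of the generators named by `w` permutes the forms through some `π` with
`π⁻¹` the value of `w` in `(0 1)(2 4), (0 2)(3 4), (0 4)`. [cite: Fischler2002Polyzetas, §3 Théorème 3.2] -/
theorem word_rel2 (hσ : ∀ p, (gσ p).1 = sigma p.1) (hψ : ∀ p, (gψ p).1 = psi 2 p.1) (hφ : ∀ p, (gφ p).1 = phi 2 p.1) (w : List ℕ) :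
    ∃ π : Perm (Fin 5),
      (∀ s t : Fin 5, s ≠ t → ∀ p,
        ℓ s t ((w.map fun m => if m = 0 then gσ else if m = 1 then gψ else gφ).prod p).1 = ℓ (π s) (π t) p.1) ∧
      (w.map fun m : ℕ => if m = 0 then swap (0 : Fin 5) 1 * swap (2 : Fin 5) 4
        else if m = 1 then swap (0 : Fin 5) 2 * swap (3 : Fin 5) 4 else swap (0 : Fin 5) 4).prod = π⁻¹ := by
  induction w with
  | nil => exact ⟨1, fun s t _ p => rfl, by simp⟩
  | cons m w ih =>
    obtain ⟨π, hrel, hJ⟩ := ih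
    by_cases h0 : m = 0
    · refine ⟨π * (swap (0 : Fin 5) 1 * swap (2 : Fin 5) 4), ?_, ?_⟩
      · simp only [List.map_cons, List.prod_cons, if_pos h0]
        exact rel_mul (rel_sigma hℓ hσ) hrel
      · have hi : (swap (0 : Fin 5) 1 * swap (2 : Fin 5) 4)⁻¹ = swap (0 : Fin 5) 1 * swap (2 : Fin 5) 4 := by decide
        simp only [List.map_cons, List.prod_cons, if_pos h0, hJ, mul_inv_rev, hi]
    · by_cases h1 : m = 1
      · refine ⟨π * (swap (0 : Fin 5) 2 * swap (3 : Fin 5) 4), ?_, ?_⟩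
        · simp only [List.map_cons, List.prod_cons, if_neg h0, if_pos h1]
          exact rel_mul (rel_psi hℓ hψ) hrel
        · have hi : (swap (0 : Fin 5) 2 * swap (3 : Fin 5) 4)⁻¹ = swap (0 : Fin 5) 2 * swap (3 : Fin 5) 4 := by decide
          simp only [List.map_cons, List.prod_cons, if_neg h0, if_pos h1, hJ, mul_inv_rev, hi]
      · refine ⟨π * swap (0 : Fin 5) 4, ?_, ?_⟩
        · simp only [List.map_cons, List.prod_cons, if_neg h0, if_neg h1]
          exact rel_mul (rel_phi hℓ hφ) hrel
        · simp only [List.map_cons, List.prod_cons, if_neg h0, if_neg h1, hJ, mul_inv_rev, swap_inv]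

/-- A product of generators lies in the group (`n = 2`). [cite: Fischler2002Polyzetas, §3 Théorème 3.2] -/
theorem word_mem2 (w : List ℕ) :
    (w.map fun m => if m = 0 then gσ else if m = 1 then gψ else gφ).prod ∈
      Subgroup.closure ({gσ, gψ, gφ} : Set (Perm {p : Exponents // InE 2 p})) := by
  refine Subgroup.list_prod_mem _ fun g hg => ?_
  simp only [List.mem_map] at hg
  obtain ⟨m, -, rfl⟩ := hg
  split_ifs <;> exact Subgroup.subset_closure (by simp)

include hℓ in
/-- **Invariance of `𝒥/N` for `n = 2`.** [cite: Fischler2002Polyzetas, §3 Théorème 3.2 (« laisse stable 𝒥(p)/(a₁! a₂! b₁! b₂! (a₁+b₂−c₂)!) »)]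
[cite: Fischler2003RhinViola, §3.3 Théorème 5] -/
theorem invariance_two_aux (hσ : ∀ p, (gσ p).1 = sigma p.1) (hψ : ∀ p, (gψ p).1 = psi 2 p.1) (hφ : ∀ p, (gφ p).1 = phi 2 p.1)
    {g : Perm {p : Exponents // InE 2 p}} (hg : g ∈ Subgroup.closure ({gσ, gψ, gφ} : Set (Perm {p : Exponents // InE 2 p})))
    (p : {p : Exponents // InE 2 p}) (hc : FinitenessCriterionGen 2 p.1) (hcg : FinitenessCriterionGen 2 (g p).1) :
    Jn 2 (g p).1 / (rvNormaliser 2 (g p).1 : ℝ≥0∞) = Jn 2 p.1 / (rvNormaliser 2 p.1 : ℝ≥0∞) := by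
  obtain ⟨π, hr⟩ := exists_rel_of_mem hℓ hσ hψ hφ hg
  -- the five criterion forms at `p`
  have hc' := (crit2_iff p.1).1 hc
  -- the sign pattern of the five other forms
  obtain ⟨b, hbdef⟩ : ∃ b : ℕ, b = (if ℓ 0 1 p.1 < 0 then 1 else 0) + (if ℓ 1 2 p.1 < 0 then 2 else 0) +
      (if ℓ 2 3 p.1 < 0 then 4 else 0) + (if ℓ 3 4 p.1 < 0 then 8 else 0) + (if ℓ 0 4 p.1 < 0 then 16 else 0) := ⟨_, rfl⟩
  obtain ⟨hb32, e1, e2, e3, e4, e5⟩ := bits5_spec (ℓ 0 1 p.1 < 0) (ℓ 1 2 p.1 < 0) (ℓ 2 3 p.1 < 0) (ℓ 3 4 p.1 < 0) (ℓ 0 4 p.1 < 0)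
  rw [← hbdef] at hb32 e1 e2 e3 e4 e5
  have link : ∀ x y : Fin 5, x ≠ y →
      (¬ ((min x.val y.val * 5 + max x.val y.val = 1 ∧ b % 2 = 1) ∨ (min x.val y.val * 5 + max x.val y.val = 7 ∧ b / 2 % 2 = 1) ∨
          (min x.val y.val * 5 + max x.val y.val = 13 ∧ b / 4 % 2 = 1) ∨ (min x.val y.val * 5 + max x.val y.val = 19 ∧ b / 8 % 2 = 1) ∨
          (min x.val y.val * 5 + max x.val y.val = 4 ∧ b / 16 % 2 = 1)) ↔ 0 ≤ ℓ x y p.1) := by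
    intro x y hxy
    rw [e1, e2, e3, e4, e5]
    obtain ⟨ha1, ha2, hb1, hb2, h5⟩ := hc'
    fin_cases x <;> fin_cases y <;> first | exact absurd rfl hxy | (simp [hℓ, not_lt, ha1, ha2, hb1, hb2]; try linarith)
  -- allowedness of `π⁻¹`
  have hal : ∀ st ∈ [((1 : Fin 5), (4 : Fin 5)), (1, 3), (0, 3), (0, 2), (2, 4)],
      ¬ ((min ((π⁻¹).symm st.1).val ((π⁻¹).symm st.2).val * 5 + max ((π⁻¹).symm st.1).val ((π⁻¹).symm st.2).val = 1 ∧
            b % 2 = 1) ∨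
          (min ((π⁻¹).symm st.1).val ((π⁻¹).symm st.2).val * 5 + max ((π⁻¹).symm st.1).val ((π⁻¹).symm st.2).val = 7 ∧
            b / 2 % 2 = 1) ∨
          (min ((π⁻¹).symm st.1).val ((π⁻¹).symm st.2).val * 5 + max ((π⁻¹).symm st.1).val ((π⁻¹).symm st.2).val = 13 ∧
            b / 4 % 2 = 1) ∨
          (min ((π⁻¹).symm st.1).val ((π⁻¹).symm st.2).val * 5 + max ((π⁻¹).symm st.1).val ((π⁻¹).symm st.2).val = 19 ∧
            b / 8 % 2 = 1) ∨
          (min ((π⁻¹).symm st.1).val ((π⁻¹).symm st.2).val * 5 + max ((π⁻¹).symm st.1).val ((π⁻¹).symm st.2).val = 4 ∧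
            b / 16 % 2 = 1)) := by
    have e : (π⁻¹).symm = π := Equiv.symm_symm π
    rw [e]
    have hcr := (crit2_iff_pi hℓ hr p).1 hcg
    intro st hst
    exact (link _ _ (fun h => by
      simp only [List.mem_cons, List.not_mem_nil, or_false] at hst
      rcases hst with rfl | rfl | rfl | rfl | rfl <;> exact absurd (π.injective h) (by decide))).2 (hcr st hst)
  obtain ⟨w, hwprod, hpath⟩ := route2 b hb32 π⁻¹ hal
  -- the group word
  obtain ⟨π', hr', hJ⟩ := word_rel2 hℓ hσ hψ hφ w
  rw [hwprod, inv_inj] at hJ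
  subst hJ
  have hwg : (w.map fun m => if m = 0 then gσ else if m = 1 then gψ else gφ).prod = g := by
    have hm := rel_mul (rel_inv hr) hr'
    rw [mul_inv_cancel] at hm
    have key := eq_one_of_rel_one hℓ hσ hψ hφ (Subgroup.mul_mem _ (Subgroup.inv_mem _ hg) (word_mem2 w))
      (fun s t hst p => by rw [hm s t hst p, Perm.one_apply, Perm.one_apply])
    rw [inv_mul_eq_one] at key
    exact key.symm
  -- the path stays inside the criterion
  have hpath' : ∀ k, k ≤ (w.map fun m => if m = 0 then gσ else if m = 1 then gψ else gφ).length →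
      FinitenessCriterionGen 2 ((((w.map fun m => if m = 0 then gσ else if m = 1 then gψ else gφ).drop k).prod p).1) := by
    intro k hk
    rw [← List.map_drop]
    obtain ⟨πk, hrk, hJk⟩ := word_rel2 hℓ hσ hψ hφ (w.drop k)
    have hak := hpath k (by simpa using hk)
    have e : ((w.drop k).map fun m : ℕ => if m = 0 then swap (0 : Fin 5) 1 * swap (2 : Fin 5) 4
        else if m = 1 then swap (0 : Fin 5) 2 * swap (3 : Fin 5) 4 else swap (0 : Fin 5) 4).prod.symm = πk := by
      rw [hJk]; exact Equiv.symm_symm πk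
    rw [e] at hak
    refine (crit2_iff_pi hℓ hrk p).2 fun st hst => (link _ _ (fun h => ?_)).1 (hak st hst)
    simp only [List.mem_cons, List.not_mem_nil, or_false] at hst
    rcases hst with rfl | rfl | rfl | rfl | rfl <;> exact absurd (πk.injective h) (by decide)
  have ht := transport (le_refl 2) hσ hψ hφ (w.map fun m => if m = 0 then gσ else if m = 1 then gψ else gφ)
    (fun g' hg' => by
      simp only [List.mem_map] at hg'
      obtain ⟨m, -, rfl⟩ := hg'
      split_ifs <;> simp) p hpath'
  rwa [hwg] at ht

end Two

/-- **Invariance of `𝒥/N` for `n = 2`** (table introduced inside). [cite: Fischler2002Polyzetas, §3 Théorème 3.2] -/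
theorem invariance_two {gσ gψ gφ : Perm {p : Exponents // InE 2 p}}
    (hσ : ∀ p, (gσ p).1 = sigma p.1) (hψ : ∀ p, (gψ p).1 = psi 2 p.1) (hφ : ∀ p, (gφ p).1 = phi 2 p.1)
    {g : Perm {p : Exponents // InE 2 p}} (hg : g ∈ Subgroup.closure ({gσ, gψ, gφ} : Set (Perm {p : Exponents // InE 2 p})))
    (p : {p : Exponents // InE 2 p}) (hc : FinitenessCriterionGen 2 p.1) (hcg : FinitenessCriterionGen 2 (g p).1) :
    Jn 2 (g p).1 / (rvNormaliser 2 (g p).1 : ℝ≥0∞) = Jn 2 p.1 / (rvNormaliser 2 p.1 : ℝ≥0∞) := by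
  obtain ⟨ℓ, hℓ⟩ : ∃ ℓ : Fin 5 → Fin 5 → Exponents → ℤ, ∀ (s t : Fin 5) (p : Exponents), ℓ s t p =
      if min s.val t.val * 5 + max s.val t.val = 1 then p.c 2
      else if min s.val t.val * 5 + max s.val t.val = 2 then p.b 2
      else if min s.val t.val * 5 + max s.val t.val = 3 then p.b 1
      else if min s.val t.val * 5 + max s.val t.val = 4 then p.a 1 - p.a 2 + p.b 1
      else if min s.val t.val * 5 + max s.val t.val = 7 then p.a 2 - p.b 1 + p.b 2
      else if min s.val t.val * 5 + max s.val t.val = 8 then p.a 2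
      else if min s.val t.val * 5 + max s.val t.val = 9 then p.a 1
      else if min s.val t.val * 5 + max s.val t.val = 13 then p.a 2 + p.b 2 - p.c 2
      else if min s.val t.val * 5 + max s.val t.val = 14 then p.a 1 + p.b 2 - p.c 2
      else if min s.val t.val * 5 + max s.val t.val = 19 then p.a 1 + p.b 1 - p.c 2 else 0 := ⟨_, fun _ _ _ => rfl⟩
  exact invariance_two_aux hℓ hσ hψ hφ hg p hc hcg

/-- **The Rhin–Viola property for `n = 2`.** [cite: Fischler2002Polyzetas, §3 Théorème 3.2] [cite: Fischler2003RhinViola, §3.3 Théorème 5] -/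
theorem isRhinViolaGroup_two {gσ gψ gφ : Perm {p : Exponents // InE 2 p}}
    (hσ : ∀ p, (gσ p).1 = sigma p.1) (hψ : ∀ p, (gψ p).1 = psi 2 p.1) (hφ : ∀ p, (gφ p).1 = phi 2 p.1) :
    IsRhinViolaGroup (fun p : {p : Exponents // InE 2 p} => Jn 2 p.1)
      (Subgroup.closure ({gσ, gψ, gφ} : Set (Perm {p : Exponents // InE 2 p}))) := by
  intro g hg p hp hgp
  have hc : FinitenessCriterionGen 2 p.1 := (Jn_finite_iff_holds 2 p.1 le_rfl).1 hp
  have hcg : FinitenessCriterionGen 2 (g p).1 := (Jn_finite_iff_holds 2 (g p).1 le_rfl).1 hgp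
  have ht := invariance_two hσ hψ hφ hg p hc hcg
  have hN := rvNormaliser_pos 2 p.1
  have hN' := rvNormaliser_pos 2 (g p).1
  refine ⟨(rvNormaliser 2 (g p).1 : ℚ) / rvNormaliser 2 p.1, ?_⟩
  have hcast : (((rvNormaliser 2 (g p).1 : ℚ) / rvNormaliser 2 p.1 : ℚ) : ℝ) =
      (rvNormaliser 2 (g p).1 : ℝ) / (rvNormaliser 2 p.1 : ℝ) := by push_cast; rfl
  rw [hcast, ENNReal.ofReal_div_of_pos (by exact_mod_cast hN), ENNReal.ofReal_natCast, ENNReal.ofReal_natCast]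
  rw [ENNReal.div_eq_div_iff (by exact_mod_cast hN.ne') (ENNReal.natCast_ne_top _) (by exact_mod_cast hN'.ne')
    (ENNReal.natCast_ne_top _)] at ht
  calc Jn 2 (g p).1 = (rvNormaliser 2 (g p).1 : ℝ≥0∞) * Jn 2 p.1 / (rvNormaliser 2 p.1 : ℝ≥0∞) :=
        (ENNReal.eq_div_iff (by exact_mod_cast hN.ne') (ENNReal.natCast_ne_top _)).2 ht
    _ = (rvNormaliser 2 (g p).1 : ℝ≥0∞) / (rvNormaliser 2 p.1 : ℝ≥0∞) * Jn 2 p.1 := by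
        rw [mul_comm (rvNormaliser 2 (g p).1 : ℝ≥0∞), mul_div_assoc, mul_comm]

/-- **Fischler's Théorème 3.2 for `n = 2` — ALL CLAUSES** (the `n = 2` case of the typed named fact): restricted permutations, the
Rhin–Viola property of `⟨σ',ψ',φ'⟩ ≅ 𝔖₅` for `(𝒥(p))_{p∈𝓔}`, the order `120 = rvGroupOrder 2`, and the invariance of
`𝒥(p)/(a₁! a₂! b₁! b₂! (a₁+b₂−c₂)!)` on criterion pairs. [cite: Fischler2002Polyzetas, §3 Théorème 3.2]
[cite: Fischler2003RhinViola, §3.3 Théorème 5, §3.4 Théorème 6] -/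
theorem theoreme32_two :
    ∃ σ' ψ' φ' : Equiv.Perm {p : Exponents // InE 2 p},
      (∀ p, (σ' p).1 = sigma p.1) ∧ (∀ p, (ψ' p).1 = psi 2 p.1) ∧ (∀ p, (φ' p).1 = phi 2 p.1) ∧
      IsRhinViolaGroup (fun p => Jn 2 p.1)
        (Subgroup.closure ({σ', ψ', φ'} : Set (Equiv.Perm {p : Exponents // InE 2 p}))) ∧
      Nat.card (Subgroup.closure ({σ', ψ', φ'} : Set (Equiv.Perm {p : Exponents // InE 2 p}))) = rvGroupOrder 2 ∧
      ∀ g ∈ Subgroup.closure ({σ', ψ', φ'} : Set (Equiv.Perm {p : Exponents // InE 2 p})),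
        ∀ p : {p : Exponents // InE 2 p},
          FinitenessCriterionGen 2 p.1 → FinitenessCriterionGen 2 (g p).1 →
            Jn 2 (g p).1 / (rvNormaliser 2 (g p).1 : ℝ≥0∞) = Jn 2 p.1 / (rvNormaliser 2 p.1 : ℝ≥0∞) := by
  obtain ⟨σ', ψ', φ', hσ, hψ, hφ⟩ := exists_perms (n := 2) le_rfl
  exact ⟨σ', ψ', φ', hσ, hψ, hφ, isRhinViolaGroup_two hσ hψ hφ, card_closure_eq_two hσ hψ hφ,
    fun g hg p hc hcg => invariance_two hσ hψ hφ hg p hc hcg⟩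

end Theoreme32

end Literature.NumberTheory.Irrationality.Fischler2002

end
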